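import Mathlib
import HarnessLib
import Summits.QuantumFields.YangMills.Theses.PencilRigidity
import Summits.QuantumFields.YangMills.Theorems.PencilRigidityCurvatureKernelBoundKernelPinning
import Summits.QuantumFields.YangMills.Theorems.HypercubicLimit.Negative.NonabelianLoadBearing
import Literature.Analysis.FunctionSpaces.TranslationInvariantDistribution

/-!
# `CurvatureKernelBound` — stub L2 `BoundedRenormalisationAxialGrowth` (support for stmt-QuantumFields-11687)

Crux `stmt-QuantumFields-11687` (`PencilRigidity.CurvatureKernelBound`), line
`sixteen-charts-analytic-kernel`, stub L2. **Statement.** Assume L1 (the truncated lattice bound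
`|LS₂(f₀,f₁) − LS₁(f₀) LS₁(f₁)| ≤ c_k² (2B)² R_k(f₀) R_k(f₁)`, `R_k(f) = a_k⁴ Σ_{x ∈ box} |f(a_k x)|`).
For `W₁`-data `(r, sch, S₁)` whose plaquette renormalisation does NOT tend to infinity in absolute
value (`∃ M, ∃ᶠ k, |c_k| ≤ M`), every kernel `K` continuous off `0` representing `S₁ 2` on `⁰𝒮₂` is
BOUNDED off the origin, so the axial growth bound holds with `η = 10`.

**Route.** Fix `ξ ≠ 0`, a continuity radius `ρ` of `K` at `ξ` (oscillation `< 1`), `ε = min(ρ,‖ξ‖)/4`,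
and standard bumps `g`, `h` of radii `(ε/2, ε)` at `ξ` and `0` (`g ⊗ h` is a real off-diagonal
tensor). (1) A lattice point count gives `R_k(g), R_k(h) ≤ (3ε)⁴` once `a_k ≤ ε`, so L1 along the
bounded subsequence and the lattice tie (`n = 2, 1`) give `‖S₁ 2 (g⊗h) − S₁ 1 g · S₁ 1 h‖ ≤ M²(2B)²(3ε)⁸`.
(2) `S₁ 1 = κ∫` by translation invariance (one-point test functions are off-diagonal), so the
disconnected part is `κ² (∫g)(∫h)`. (3) `S₁ 2 (g⊗h) = ∫ K(x₀−x₁) g(x₀) h(x₁)` with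
`‖K(x₀−x₁) − K(ξ)‖ ≤ 1` on the support, so `‖S₁ 2 (g⊗h) − K(ξ)(∫g)(∫h)‖ ≤ (∫g)(∫h)`, while
`∫g, ∫h ≥ vol B̄(ε/2) = (ε/2)⁴ v₁`. Dividing: `‖K(ξ)‖ ≤ ‖κ‖² + 1 + M²(2B)² 6⁸/v₁²`. [folklore]
-/

noncomputable section

open scoped BigOperators Topology SchwartzMap ComplexConjugate
open MeasureTheory Filter Set
open Literature.MathematicalPhysics.QuantumLattice Literature.MathematicalPhysics.AQFT
open Literature.MathematicalPhysics.QuantumFieldTheory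
open Literature.Probability.LatticeModels (Site box mem_box)

namespace Summit.QuantumFields.YangMills.Theorems.CurvatureKernel

namespace BoundedRenormalisation

/-- **Lattice point count** for (a copy `φ` of) a standard bump `g` of outer radius `r`: for meshes
`0 < a ≤ r` and every box, `a⁴ Σ_{x ∈ box} |φ(a x)| ≤ (3r)⁴` — each coordinate of a contributing
site lies in an interval of length `2r/a`, which holds at most `2r/a + 1` integers, and `0 ≤ g ≤ 1`.
[folklore] -/
theorem latticeSum_bump_le {p : EuclideanSpace ℝ (Fin 4)} (g : ContDiffBump p)
    {φ : EuclideanSpace ℝ (Fin 4) → ℝ} (hφ : ∀ y, φ y = g y) {a : ℝ} (ha : 0 < a)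
    (haε : a ≤ g.rOut) (L : ℕ) :
    a ^ 4 * ∑ x ∈ box 4 L, |φ (a • siteToE x)| ≤ (3 * g.rOut) ^ 4 := by
  -- the contributing sites lie in a product of integer intervals
  set T : Finset (Site 4) := Fintype.piFinset fun i : Fin 4 =>
    Finset.Icc ⌈(p i - g.rOut) / a⌉ ⌊(p i + g.rOut) / a⌋ with hT
  have hsub : (box 4 L).filter (fun x => φ (a • siteToE x) ≠ 0) ⊆ T := by
    intro x hx
    rw [Finset.mem_filter, hφ] at hx
    have hball : dist (a • siteToE x) p < g.rOut :=
      lt_of_not_ge fun h' => hx.2 (g.zero_of_le_dist h')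
    rw [dist_eq_norm] at hball
    rw [hT, Fintype.mem_piFinset]
    intro i
    have hi : |a * (x i : ℝ) - p i| < g.rOut := by
      have h1 : |(a • siteToE x - p) i| ≤ ‖a • siteToE x - p‖ := by
        simpa using PiLp.norm_apply_le (a • siteToE x - p) i
      rw [PiLp.sub_apply, PiLp.smul_apply, siteToE_apply, smul_eq_mul] at h1
      exact lt_of_le_of_lt h1 hball
    rw [abs_lt] at hi
    rw [Finset.mem_Icc, Int.ceil_le, Int.le_floor, div_le_iff₀ ha, le_div_iff₀ ha]
    constructor <;> linarith
  have hsum : ∑ x ∈ box 4 L, |φ (a • siteToE x)| ≤ (T.card : ℝ) := by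
    calc ∑ x ∈ box 4 L, |φ (a • siteToE x)|
        = ∑ x ∈ (box 4 L).filter (fun x => φ (a • siteToE x) ≠ 0), |φ (a • siteToE x)| :=
          (Finset.sum_filter_of_ne fun x _ h => abs_ne_zero.mp h).symm
      _ ≤ ∑ x ∈ (box 4 L).filter (fun x => φ (a • siteToE x) ≠ 0), (1 : ℝ) :=
          Finset.sum_le_sum fun x _ => by rw [hφ, abs_of_nonneg g.nonneg]; exact g.le_one
      _ ≤ (T.card : ℝ) := by
          rw [Finset.sum_const, nsmul_eq_mul, mul_one]
          exact_mod_cast Finset.card_le_card hsub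
  have hcard : (T.card : ℝ) ≤ (2 * g.rOut / a + 1) ^ 4 := by
    rw [hT, Fintype.card_piFinset]
    push_cast
    rw [show (2 * g.rOut / a + 1) ^ 4 = ∏ _i : Fin 4, (2 * g.rOut / a + 1) by
      rw [Finset.prod_const, Finset.card_univ, Fintype.card_fin]]
    refine Finset.prod_le_prod (fun i _ => by positivity) fun i _ => ?_
    rw [Int.card_Icc]
    have h1 : (⌊(p i + g.rOut) / a⌋ : ℝ) ≤ (p i + g.rOut) / a := Int.floor_le _
    have h2 : (p i - g.rOut) / a ≤ (⌈(p i - g.rOut) / a⌉ : ℝ) := Int.le_ceil _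
    have h3 : (p i + g.rOut) / a - (p i - g.rOut) / a = 2 * g.rOut / a := by ring
    have h4 : (0 : ℝ) ≤ 2 * g.rOut / a := div_nonneg (by linarith [g.rOut_pos]) ha.le
    have hN : (((⌊(p i + g.rOut) / a⌋ + 1 - ⌈(p i - g.rOut) / a⌉).toNat : ℕ) : ℝ) =
        max ((⌊(p i + g.rOut) / a⌋ : ℝ) + 1 - (⌈(p i - g.rOut) / a⌉ : ℝ)) 0 := by
      rw [← Int.cast_natCast, Int.toNat_eq_max]
      push_cast
      rfl
    rw [hN]
    exact max_le (by linarith) (by linarith)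
  calc a ^ 4 * ∑ x ∈ box 4 L, |φ (a • siteToE x)| ≤ a ^ 4 * (2 * g.rOut / a + 1) ^ 4 :=
        mul_le_mul_of_nonneg_left (hsum.trans hcard) (by positivity)
    _ = (2 * g.rOut + a) ^ 4 := by rw [← mul_pow]; congr 1; field_simp
    _ ≤ (3 * g.rOut) ^ 4 := pow_le_pow_left₀ (by linarith [g.rOut_pos]) (by linarith) 4

/-- **Bump localisation.** Let `g`, `h` be standard bumps centred at `ξ` and `0` with
`r_out(g) + r_out(h) ≤ ρ`, `ρ` a continuity radius of `K` at `ξ` with oscillation `< 1`, and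
`F = g ⊗ h` pointwise. Then `‖∫ K(x₀−x₁) F(x) dx − K(ξ) (∫g)(∫h)‖ ≤ (∫g)(∫h)` (on the support of
`F ≥ 0` the point `x₀ − x₁` is `ρ`-close to `ξ`; Fubini). [folklore] -/
theorem norm_integral_kernel_bumps_sub_le {K : EuclideanSpace ℝ (Fin 4) → ℂ}
    {ξ : EuclideanSpace ℝ (Fin 4)} {ρ : ℝ}
    (hρK : ∀ z : EuclideanSpace ℝ (Fin 4), dist z ξ < ρ → dist (K z) (K ξ) < 1)
    (g : ContDiffBump ξ) (h : ContDiffBump (0 : EuclideanSpace ℝ (Fin 4)))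
    (hgh : g.rOut + h.rOut ≤ ρ) {F : (Fin 2 → EuclideanSpace ℝ (Fin 4)) → ℂ}
    (F_apply : ∀ x : Fin 2 → EuclideanSpace ℝ (Fin 4), F x = ((g (x 0) * h (x 1) : ℝ) : ℂ))
    (hFi : Integrable F)
    (hint : Integrable (fun x : Fin 2 → EuclideanSpace ℝ (Fin 4) => K (x 0 - x 1) * F x)) :
    ‖(∫ x : Fin 2 → EuclideanSpace ℝ (Fin 4), K (x 0 - x 1) * F x) -
      K ξ * (((∫ y, g y) * ∫ y, h y : ℝ) : ℂ)‖ ≤ (∫ y, g y) * ∫ y, h y := by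
  -- the real tensor `g ⊗ h`: integrable, with integral `(∫g)(∫h)` (Fubini)
  have hintgh : Integrable (fun x : Fin 2 → EuclideanSpace ℝ (Fin 4) => g (x 0) * h (x 1)) := by
    refine hFi.norm.congr (Eventually.of_forall fun x => ?_)
    show ‖F x‖ = g (x 0) * h (x 1)
    rw [F_apply, Complex.norm_real, Real.norm_of_nonneg (mul_nonneg g.nonneg h.nonneg)]
  have hIgh : ∫ x : Fin 2 → EuclideanSpace ℝ (Fin 4), g (x 0) * h (x 1) = (∫ y, g y) * ∫ y, h y := by
    simpa [Fin.prod_univ_two] using integral_fintype_prod_volume_eq_prod (𝕜 := ℝ)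
      (E := fun _ : Fin 2 => EuclideanSpace ℝ (Fin 4)) ![(g : EuclideanSpace ℝ (Fin 4) → ℝ), h]
  have hIF : ∫ x : Fin 2 → EuclideanSpace ℝ (Fin 4), F x = (((∫ y, g y) * ∫ y, h y : ℝ) : ℂ) := by
    rw [integral_congr_ae (Eventually.of_forall F_apply), integral_complex_ofReal, hIgh]
  -- pointwise bound on the support of `g ⊗ h`
  have hK1 : ∀ x : Fin 2 → EuclideanSpace ℝ (Fin 4),
      ‖(K (x 0 - x 1) - K ξ) * F x‖ ≤ g (x 0) * h (x 1) := by
    intro x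
    rw [F_apply]
    by_cases hgh0 : g (x 0) * h (x 1) = 0
    · rw [hgh0]
      simp
    obtain ⟨hg1, hh1⟩ := mul_ne_zero_iff.1 hgh0
    have hg2 : dist (x 0) ξ < g.rOut := lt_of_not_ge fun h' => hg1 (g.zero_of_le_dist h')
    have hh2 : dist (x 1) 0 < h.rOut := lt_of_not_ge fun h' => hh1 (h.zero_of_le_dist h')
    rw [dist_eq_norm] at hg2 hh2
    rw [sub_zero] at hh2
    have hd : dist (x 0 - x 1) ξ < ρ := by
      rw [dist_eq_norm]
      calc ‖x 0 - x 1 - ξ‖ = ‖(x 0 - ξ) - x 1‖ := by congr 1; abel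
        _ ≤ ‖x 0 - ξ‖ + ‖x 1‖ := norm_sub_le _ _
        _ < ρ := by linarith
    have hKx := hρK _ hd
    rw [dist_eq_norm] at hKx
    have hprod : 0 ≤ g (x 0) * h (x 1) := mul_nonneg g.nonneg h.nonneg
    rw [norm_mul, Complex.norm_real, Real.norm_of_nonneg hprod]
    exact mul_le_of_le_one_left hprod hKx.le
  have hdiff : (∫ x : Fin 2 → EuclideanSpace ℝ (Fin 4), K (x 0 - x 1) * F x) -
      K ξ * (((∫ y, g y) * ∫ y, h y : ℝ) : ℂ) =
      ∫ x : Fin 2 → EuclideanSpace ℝ (Fin 4), (K (x 0 - x 1) - K ξ) * F x := by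
    rw [← hIF, ← integral_const_mul, ← integral_sub hint (hFi.const_mul (K ξ))]
    congr 1
    funext x
    ring
  rw [hdiff, ← hIgh]
  exact norm_integral_le_of_norm_le hintgh (Eventually.of_forall hK1)

/-- The integral of a standard bump dominates the volume of its inner ball:
`r_in⁴ · vol B̄(0,1) ≤ ∫ g` on `ℝ⁴`. [folklore] -/
theorem rIn_pow_mul_le_integral {c : EuclideanSpace ℝ (Fin 4)} (g : ContDiffBump c) :
    g.rIn ^ 4 * (volume : Measure (EuclideanSpace ℝ (Fin 4))).real
      (Metric.closedBall (0 : EuclideanSpace ℝ (Fin 4)) 1) ≤ ∫ y, g y := by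
  have h1 := g.measure_closedBall_le_integral (volume : Measure (EuclideanSpace ℝ (Fin 4)))
  rwa [Measure.addHaar_real_closedBall' volume c g.rIn_pos.le, finrank_euclideanSpace_fin] at h1

/-- Real test functions agreeing with standard bumps of outer radius `ε ≤ ‖ξ‖/4` centred at
`ξ ≠ 0` and at `0` have disjoint supports (after complexification). [folklore] -/
theorem disjoint_tsupport_of_bumps {ξ : EuclideanSpace ℝ (Fin 4)} {ε : ℝ} (hεξ : ε ≤ ‖ξ‖ / 4)
    (hn0 : 0 < ‖ξ‖) (g : ContDiffBump ξ) (h : ContDiffBump (0 : EuclideanSpace ℝ (Fin 4)))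
    (hg : g.rOut = ε) (hh : h.rOut = ε) (gS hS : 𝓢(EuclideanSpace ℝ (Fin 4), ℝ))
    (hgS : ∀ y, gS y = g y) (hhS : ∀ y, hS y = h y) :
    Disjoint (tsupport (ofRealTest gS : EuclideanSpace ℝ (Fin 4) → ℂ))
      (tsupport (ofRealTest hS : EuclideanSpace ℝ (Fin 4) → ℂ)) := by
  have key : ∀ {c : EuclideanSpace ℝ (Fin 4)} (b : ContDiffBump c) (f : 𝓢(EuclideanSpace ℝ (Fin 4), ℝ)),
      (∀ y, f y = b y) → tsupport (ofRealTest f : EuclideanSpace ℝ (Fin 4) → ℂ) ⊆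
        Metric.closedBall c b.rOut := by
    intro c b f hf
    rw [← b.tsupport_eq]
    refine closure_mono fun y hy => ?_
    have hy' : (f y : ℂ) ≠ 0 := hy
    rw [Complex.ofReal_ne_zero, hf] at hy'
    exact hy'
  refine Set.disjoint_left.2 fun x hxg hxh => ?_
  have h1 := key g gS hgS hxg
  have h2 := key h hS hhS hxh
  rw [Metric.mem_closedBall, dist_eq_norm, hg] at h1
  rw [Metric.mem_closedBall, dist_zero_right, hh] at h2
  linarith [norm_le_insert' ξ x, norm_sub_rev ξ x]

/-- **Lattice side.** If real sequences `LS₂, LS_g, LS_h` (the smeared lattice two- and one-point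
functions of the bumps) obey the bound of stub L1, `|LS₂ − LS_g LS_h| ≤ c_k² (2B)² R_k(g) R_k(h)`,
and along `φ` one has `|c_{φ j}| ≤ M`, `a_{φ j} → 0`, then eventually along `φ`
`‖LS₂ − LS_g LS_h‖ ≤ M² (2B)² (3 r_g)⁴ (3 r_h)⁴` (lattice point count). [folklore] -/
theorem eventually_norm_truncated_le {ξ : EuclideanSpace ℝ (Fin 4)} (g : ContDiffBump ξ)
    (h : ContDiffBump (0 : EuclideanSpace ℝ (Fin 4)))
    {gS hS : EuclideanSpace ℝ (Fin 4) → ℝ} (hgS : ∀ y, gS y = g y) (hhS : ∀ y, hS y = h y)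
    {LS₂ LSg LSh c a : ℕ → ℝ} {L : ℕ → ℕ} {B M : ℝ} {φ : ℕ → ℕ}
    (ha : ∀ k, 0 < a k) (hφa : Tendsto (fun j => a (φ j)) atTop (𝓝 0))
    (hφM : ∀ j, |c (φ j)| ≤ M)
    (hL1 : ∀ k, |LS₂ k - LSg k * LSh k| ≤ c k ^ 2 * (2 * B) ^ 2 *
      (a k ^ 4 * ∑ x ∈ box 4 (L k), |gS (a k • siteToE x)|) *
      (a k ^ 4 * ∑ x ∈ box 4 (L k), |hS (a k • siteToE x)|)) :
    ∀ᶠ j in atTop, ‖((LS₂ (φ j) : ℝ) : ℂ) - ((LSg (φ j) : ℝ) : ℂ) * ((LSh (φ j) : ℝ) : ℂ)‖ ≤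
      M ^ 2 * (2 * B) ^ 2 * (3 * g.rOut) ^ 4 * (3 * h.rOut) ^ 4 := by
  filter_upwards [hφa.eventually (gt_mem_nhds (lt_min g.rOut_pos h.rOut_pos))] with j hj
  have hjg : a (φ j) ≤ g.rOut := hj.le.trans (min_le_left _ _)
  have hjh : a (φ j) ≤ h.rOut := hj.le.trans (min_le_right _ _)
  rw [← Complex.ofReal_mul, ← Complex.ofReal_sub, Complex.norm_real, Real.norm_eq_abs]
  refine (hL1 (φ j)).trans ?_
  have hM0 : 0 ≤ M := (abs_nonneg _).trans (hφM j)
  have hc2 : c (φ j) ^ 2 ≤ M ^ 2 := by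
    rw [← sq_abs]
    exact pow_le_pow_left₀ (abs_nonneg _) (hφM j) 2
  have hRg := latticeSum_bump_le g hgS (ha (φ j)) hjg (L (φ j))
  have hRh := latticeSum_bump_le h hhS (ha (φ j)) hjh (L (φ j))
  gcongr ?_ * _ * ?_ * ?_

/-- **Algebra of the three estimates.** From `‖S − κI₀ · κI₁‖ ≤ M²(2B)²(3ε)⁸` (lattice side),
`‖K(ξ) I₀I₁ − S‖ ≤ I₀I₁` (bump localisation) and `I₀, I₁ ≥ (ε/2)⁴ v₁` (inner balls):
`‖K(ξ)‖ ≤ ‖κ‖² + 1 + M²(2B)² 6⁸ / v₁²`. [folklore] -/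
theorem norm_le_of_estimates {Kξ S κ : ℂ} {I₀ I₁ M B ε v₁ : ℝ} (hv₁ : 0 < v₁) (hε : 0 < ε)
    (hI₀ : (ε / 2) ^ 4 * v₁ ≤ I₀) (hI₁ : (ε / 2) ^ 4 * v₁ ≤ I₁)
    (hZ : ‖S - κ * (I₀ : ℂ) * (κ * (I₁ : ℂ))‖ ≤ M ^ 2 * (2 * B) ^ 2 * (3 * ε) ^ 4 * (3 * ε) ^ 4)
    (h2 : ‖Kξ * ((I₀ * I₁ : ℝ) : ℂ) - S‖ ≤ I₀ * I₁) :
    ‖Kξ‖ ≤ ‖κ‖ ^ 2 + 1 + M ^ 2 * (2 * B) ^ 2 * 6 ^ 8 / v₁ ^ 2 := by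
  have hQ0 : 0 ≤ M ^ 2 * (2 * B) ^ 2 * 6 ^ 8 / v₁ ^ 2 := by positivity
  have hlow : 0 < (ε / 2) ^ 4 * v₁ := by positivity
  have hI₀pos : 0 < I₀ := hlow.trans_le hI₀
  have hP : 0 < I₀ * I₁ := mul_pos hI₀pos (hlow.trans_le hI₁)
  have hD : M ^ 2 * (2 * B) ^ 2 * (3 * ε) ^ 4 * (3 * ε) ^ 4 ≤
      M ^ 2 * (2 * B) ^ 2 * 6 ^ 8 / v₁ ^ 2 * (I₀ * I₁) := by
    have hQ : M ^ 2 * (2 * B) ^ 2 * (3 * ε) ^ 4 * (3 * ε) ^ 4 =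
        M ^ 2 * (2 * B) ^ 2 * 6 ^ 8 / v₁ ^ 2 * ((ε / 2) ^ 4 * v₁ * ((ε / 2) ^ 4 * v₁)) := by
      field_simp
      ring
    rw [hQ]
    exact mul_le_mul_of_nonneg_left (mul_le_mul hI₀ hI₁ hlow.le hI₀pos.le) hQ0
  have e1 : ‖Kξ‖ * (I₀ * I₁) = ‖Kξ * ((I₀ * I₁ : ℝ) : ℂ)‖ := by
    rw [norm_mul, Complex.norm_real, Real.norm_of_nonneg hP.le]
  have e2 : ‖κ * (I₀ : ℂ) * (κ * (I₁ : ℂ))‖ = ‖κ‖ ^ 2 * (I₀ * I₁) := by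
    rw [show κ * (I₀ : ℂ) * (κ * (I₁ : ℂ)) = κ ^ 2 * ((I₀ * I₁ : ℝ) : ℂ) by push_cast; ring,
      norm_mul, norm_pow, Complex.norm_real, Real.norm_of_nonneg hP.le]
  have tri : ‖Kξ * ((I₀ * I₁ : ℝ) : ℂ)‖ ≤ ‖Kξ * ((I₀ * I₁ : ℝ) : ℂ) - S‖ +
      ‖S - κ * (I₀ : ℂ) * (κ * (I₁ : ℂ))‖ + ‖κ * (I₀ : ℂ) * (κ * (I₁ : ℂ))‖ := by
    calc ‖Kξ * ((I₀ * I₁ : ℝ) : ℂ)‖ = ‖(Kξ * ((I₀ * I₁ : ℝ) : ℂ) - S) +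
          (S - κ * (I₀ : ℂ) * (κ * (I₁ : ℂ))) + κ * (I₀ : ℂ) * (κ * (I₁ : ℂ))‖ := by
          congr 1; ring
      _ ≤ _ := norm_add₃_le
  have hkey : ‖Kξ‖ * (I₀ * I₁) ≤
      (‖κ‖ ^ 2 + 1 + M ^ 2 * (2 * B) ^ 2 * 6 ^ 8 / v₁ ^ 2) * (I₀ * I₁) := by
    rw [e1]
    linarith [tri, h2, hZ, e2, hD]
  exact le_of_mul_le_mul_right hkey hP

/-- **Degree one is `κ∫` on real one-point tensors** (real-integral form). If `S₁` is
translation invariant on `⁰𝒮` then `S₁ 1 F₀ = κ · ↑(∫ f)` for every one-fold tensor `F₀` of a real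
test function `f`: every one-point test function is off-diagonal, so the pull-back of `S₁ 1` along
`(Fin 1 → ℝ⁴) ≃L[ℝ] ℝ⁴`, `x ↦ x 0`, is a translation-invariant tempered distribution, hence `κ∫`
(argument adapted from the landed degenerate branch `DegenerateAxial`). [folklore] -/
theorem exists_degreeOne_eq_const_mul_realIntegral (S₁ : SchwingerFamily (EuclideanSpace ℝ (Fin 4)))
    (htr : ∀ (n : ℕ) (a : EuclideanSpace ℝ (Fin 4)) (F : 𝓢((Fin n → EuclideanSpace ℝ (Fin 4)), ℂ)),
      IsOffDiagonal F → S₁ n (translateMulti a F) = S₁ n F) :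
    ∃ κ : ℂ, ∀ (f : 𝓢(EuclideanSpace ℝ (Fin 4), ℝ)) (F₀ : 𝓢((Fin 1 → EuclideanSpace ℝ (Fin 4)), ℂ)),
      IsTensorOf F₀ (fun _ => ofRealTest f) →
        S₁ 1 F₀ = κ * ((∫ x : EuclideanSpace ℝ (Fin 4), f x : ℝ) : ℂ) := by
  have coordOne_apply : ∀ x : Fin 1 → EuclideanSpace ℝ (Fin 4),
      ContinuousLinearEquiv.funUnique (Fin 1) ℝ (EuclideanSpace ℝ (Fin 4)) x = x 0 := fun x => by
    rw [ContinuousLinearEquiv.coe_funUnique, Function.eval, Fin.default_eq_zero]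
  let P : 𝓢(EuclideanSpace ℝ (Fin 4), ℂ) →L[ℂ] 𝓢((Fin 1 → EuclideanSpace ℝ (Fin 4)), ℂ) :=
    SchwartzMap.compCLMOfContinuousLinearEquiv ℂ
      (ContinuousLinearEquiv.funUnique (Fin 1) ℝ (EuclideanSpace ℝ (Fin 4)))
  let T₁ : 𝓢(EuclideanSpace ℝ (Fin 4), ℂ) →L[ℂ] ℂ := (S₁ 1).comp P
  have hT₁ : ∀ (a : EuclideanSpace ℝ (Fin 4)) (u : 𝓢(EuclideanSpace ℝ (Fin 4), ℂ)),
      T₁ (SchwartzMap.compSubConstCLM ℂ a u) = T₁ u := by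
    intro a u
    have hc : P (SchwartzMap.compSubConstCLM ℂ a u) = translateMulti a (P u) := by
      ext x
      rw [translateMulti_apply, SchwartzMap.compCLMOfContinuousLinearEquiv_apply,
        SchwartzMap.compCLMOfContinuousLinearEquiv_apply, Function.comp_apply, Function.comp_apply,
        SchwartzMap.compSubConstCLM_apply, coordOne_apply, coordOne_apply]
    change S₁ 1 (P (SchwartzMap.compSubConstCLM ℂ a u)) = S₁ 1 (P u)
    rw [hc, htr 1 a _ (HypercubicLimit.Negative.isOffDiagonal_fin_one _)]
  obtain ⟨κ, hκ⟩ :=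
    Literature.Analysis.FunctionSpaces.exists_eq_const_mul_integral_of_forall_compSubConstCLM T₁ hT₁
  refine ⟨κ, fun f F₀ hF₀ => ?_⟩
  have hF : F₀ = P (ofRealTest f) := by
    ext x
    rw [hF₀ x, Fin.prod_univ_one, SchwartzMap.compCLMOfContinuousLinearEquiv_apply,
      Function.comp_apply, coordOne_apply]
  rw [hF, ← integral_complex_ofReal]
  exact hκ (ofRealTest f)

end BoundedRenormalisation

open BoundedRenormalisation in
/-- **`BoundedRenormalisationAxialGrowth`** (Stub L2 of line `sixteen-charts-analytic-kernel`, crux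
`PencilRigidity.CurvatureKernelBound`, registered signature verbatim). Assume L1 (the truncated
lattice two-point bound). For `W₁`-data `(r, sch, S₁)` whose multiplicative renormalisation of the
plaquette field does NOT tend to infinity in absolute value (`∃ M, ∃ᶠ k, |c_k| ≤ M`), every
kernel `K` continuous off `0` representing `S₁ 2` on `⁰𝒮₂` is bounded off the origin, by
`‖κ‖² + 1 + M² (2B)² 6⁸ / v₁²` (`S₁ 1 = κ∫`, `|tr F²| ≤ B` on the lattice, `v₁ = vol B̄(0,1)`), hence
obeys the axial growth bound with `η = 10`. [folklore] -/
theorem BoundedRenormalisationAxialGrowth : open Literature.MathematicalPhysics.QuantumLattice Literature.MathematicalPhysics.AQFT Literature.MathematicalPhysics.QuantumFieldTheory in (∀ (G : Type) [Group G] [TopologicalSpace G] [IsTopologicalGroup G] [CompactSpace G] [MeasurableSpace G] [BorelSpace G] (r : LatticeRep G) (sch : SpeciesScheme (YMSpecies G)) (A : YMSpecies G) (B : ℝ), (∀ U : LGConfig 4 G, |A.F U| ≤ B) → ∀ (k : ℕ) (f : Fin 2 → SchwartzMap (EuclideanSpace ℝ (Fin 4)) ℝ), |latticeSchwinger r.ρ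 sch (fun s => s.F) k 2 (fun _ => A) f - latticeSchwinger r.ρ sch (fun s => s.F) k 1 (fun _ => A) (fun _ => f 0) * latticeSchwinger r.ρ sch (fun s => s.F) k 1 (fun _ => A) (fun _ => f 1)| ≤ (sch.c A k) ^ 2 * (2 * B) ^ 2 * ((sch.a k) ^ 4 * ∑ x ∈ Literature.Probability.LatticeModels.box 4 (sch.L k), |f 0 (sch.a k • siteToE x)|) * ((sch.a k) ^ 4 * ∑ x ∈ Literature.Probability.LatticeModels.box 4 (sch.L k), |f 1 (sch.a k • siteToE x)|)) → ∀ (G : Type) [Group G] [TopologicalSpace G] [IsTopologicalGroup G] [CompactSpace G] [MeasurableSpace G] [BorelSpace G], IsCompactSimpleLieGroup G → ∀ (r : LatticeRep G) (sch : SpeciesScheme (YMSpecies G)) (S₁ : SchwingerFamily (EuclideanSpace ℝ (Fin 4))), ((∀ (n : ℕ), n ≠ 0 → ∀ (f : Fin n → SchwartzMap (EuclideanSpace ℝ (Fin 4)) ℝ) (F : SchwartzMap (Fin n → (EuclideanSpace ℝ (Fin 4))) ℂ), IsTensorOf F (fun i => ofRealTest (f i)) → IsOffDiagonal F → Filter.Tendsto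 (fun k : ℕ => ((latticeSchwinger r.ρ sch (fun s => s.F) k n (fun _ => r.curvature) f : ℝ) : ℂ)) Filter.atTop (nhds (S₁ n F))) ∧ (S₁.toLabelled.IsNormalized ∧ S₁.toLabelled.IsHermitian ∧ S₁.toLabelled.HasLinearGrowth ∧ S₁.toLabelled.IsReflectionPositive ∧ S₁.toLabelled.IsSymmetric ∧ S₁.toLabelled.HasClusterProperty) ∧ (∀ (n : ℕ) (a : (EuclideanSpace ℝ (Fin 4))) (F : SchwartzMap (Fin n → (EuclideanSpace ℝ (Fin 4))) ℂ), IsOffDiagonal F → S₁ n (translateMulti a F) = S₁ n F) ∧ (∀ (R : (EuclideanSpace ℝ (Fin 4)) ≃ₗᵢ[ℝ] (EuclideanSpace ℝ (Fin 4))), LinearMap.det (R.toLinearEquiv : (EuclideanSpace ℝ (Fin 4)) →ₗ[ℝ] (EuclideanSpace ℝ (Fin 4))) = 1 → (∀ i : Fin 4, ∃ j : Fin 4, R (EuclideanSpace.single i 1) = EuclideanSpace.single j 1 ∨ R (EuclideanSpace.single i 1) = -EuclideanSpace.single j 1) → ∀ (n : ℕ) (F : SchwartzMap (Fin n → (EuclideanSpace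 ℝ (Fin 4))) ℂ), IsOffDiagonal F → S₁ n (linActMulti R F) = S₁ n F) ∧ (∃ Δ : ℝ, 0 < Δ ∧ S₁.toLabelled.HasMassGap Δ ∧ HasLatticeMassGap r sch Δ)) → (∃ M : ℝ, ∃ᶠ k in Filter.atTop, |sch.c r.curvature k| ≤ M) → ∀ (K : (EuclideanSpace ℝ (Fin 4)) → ℂ), ContinuousOn K {x : (EuclideanSpace ℝ (Fin 4)) | x ≠ 0} → (∀ F : SchwartzMap (Fin 2 → (EuclideanSpace ℝ (Fin 4))) ℂ, IsOffDiagonal F → MeasureTheory.Integrable (fun x : Fin 2 → (EuclideanSpace ℝ (Fin 4)) => K (x 0 - x 1) * F x) ∧ S₁ 2 F = ∫ x : Fin 2 → (EuclideanSpace ℝ (Fin 4)), K (x 0 - x 1) * F x) → ∃ C η : ℝ, 0 < η ∧ ∀ s : ℝ, 0 < s → s ≤ 1 → ‖K (EuclideanSpace.single 0 s)‖ ≤ C * s ^ (η - 10) := by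
  intro hL1 G _ _ _ _ _ _ _ r sch S₁ hW₁ hM K hcont hrep
  obtain ⟨htie, -, htr, -, -⟩ := hW₁
  obtain ⟨M, hM⟩ := hM
  obtain ⟨B, hB⟩ := r.curvature.bounded
  obtain ⟨κ, hκ⟩ := exists_degreeOne_eq_const_mul_realIntegral S₁ htr
  -- a subsequence along which the renormalisation is bounded
  obtain ⟨φ, hφmono, hφM⟩ := Filter.extraction_of_frequently_atTop hM
  have hφa : Tendsto (fun j => sch.a (φ j)) atTop (𝓝 0) := sch.tendsto_a.comp hφmono.tendsto_atTop
  -- Lebesgue measure on `(ℝ⁴)²` has temperate growth (Schwartz functions are integrable)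
  haveI : (volume : Measure (Fin 2 → EuclideanSpace ℝ (Fin 4))).HasTemperateGrowth :=
    Measure.IsAddHaarMeasure.instHasTemperateGrowth
  -- the volume of the unit ball
  obtain ⟨v₁, hv₁def⟩ : ∃ v : ℝ, (volume : Measure (EuclideanSpace ℝ (Fin 4))).real
      (Metric.closedBall (0 : EuclideanSpace ℝ (Fin 4)) 1) = v := ⟨_, rfl⟩
  have hv₁ : 0 < v₁ := by
    rw [← hv₁def]
    exact ENNReal.toReal_pos (Metric.measure_closedBall_pos volume _ one_pos).ne'
      measure_closedBall_lt_top.ne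
  -- ### the kernel is bounded off the origin
  have hbound : ∀ ξ : EuclideanSpace ℝ (Fin 4), ξ ≠ 0 →
      ‖K ξ‖ ≤ ‖κ‖ ^ 2 + 1 + M ^ 2 * (2 * B) ^ 2 * 6 ^ 8 / v₁ ^ 2 := by
    intro ξ hξ
    -- a continuity radius of `K` at `ξ`
    have hKat : ContinuousAt K ξ := (hcont ξ hξ).continuousAt (isOpen_compl_singleton.mem_nhds hξ)
    obtain ⟨ρ, hρ, hρK⟩ := Metric.continuousAt_iff.1 hKat 1 one_pos
    have hρK' : ∀ z : EuclideanSpace ℝ (Fin 4), dist z ξ < ρ → dist (K z) (K ξ) < 1 :=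
      fun z hz => hρK hz
    have hn0 : 0 < ‖ξ‖ := norm_pos_iff.2 hξ
    -- the bumps, of radii `(ε/2, ε)` with `ε = min(ρ, ‖ξ‖)/4`, and the tensors
    obtain ⟨ε, hε, hερ, hεξ⟩ : ∃ ε : ℝ, 0 < ε ∧ ε ≤ ρ / 4 ∧ ε ≤ ‖ξ‖ / 4 :=
      ⟨min (ρ / 4) (‖ξ‖ / 4), lt_min (by linarith) (by linarith), min_le_left _ _, min_le_right _ _⟩
    let g : ContDiffBump ξ := ⟨ε / 2, ε, by linarith, by linarith⟩
    let h : ContDiffBump (0 : EuclideanSpace ℝ (Fin 4)) := ⟨ε / 2, ε, by linarith, by linarith⟩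
    have hgr : g.rOut = ε := rfl
    have hhr : h.rOut = ε := rfl
    let gS : 𝓢(EuclideanSpace ℝ (Fin 4), ℝ) := g.hasCompactSupport.toSchwartzMap g.contDiff
    let hS : 𝓢(EuclideanSpace ℝ (Fin 4), ℝ) := h.hasCompactSupport.toSchwartzMap h.contDiff
    have gS_apply : ∀ x, gS x = g x := fun _ => rfl
    have hS_apply : ∀ x, hS x = h x := fun _ => rfl
    let F : 𝓢((Fin 2 → EuclideanSpace ℝ (Fin 4)), ℂ) := SchwartzMap.tensorFin 2 ![ofRealTest gS, ofRealTest hS]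
    have F_apply : ∀ x : Fin 2 → EuclideanSpace ℝ (Fin 4), F x = ((g (x 0) * h (x 1) : ℝ) : ℂ) := by
      intro x
      rw [tensorFin_two_apply, ofRealTest_apply, ofRealTest_apply, gS_apply, hS_apply]
      push_cast
      rfl
    have hFt : IsTensorOf F (fun i => ofRealTest (![gS, hS] i)) := isTensorOf_tensorFin_two_ofRealTest gS hS
    have hFoff : IsOffDiagonal F := isOffDiagonal_tensorFin_two
      (disjoint_tsupport_of_bumps hεξ hn0 g h hgr hhr gS hS gS_apply hS_apply)
    obtain ⟨F₀, hF₀⟩ := exists_isTensorOf (n := 1) (fun _ : Fin 1 => ofRealTest gS)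
    obtain ⟨F₁, hF₁⟩ := exists_isTensorOf (n := 1) (fun _ : Fin 1 => ofRealTest hS)
    -- the integrals of the bumps dominate the volume of the inner balls
    have hI₀ : (ε / 2) ^ 4 * v₁ ≤ ∫ y, g y := by
      have h1 := rIn_pow_mul_le_integral g
      rwa [hv₁def] at h1
    have hI₁ : (ε / 2) ^ 4 * v₁ ≤ ∫ y, h y := by
      have h1 := rIn_pow_mul_le_integral h
      rwa [hv₁def] at h1
    -- (1) lattice side: L1 for the bumps along the bounded subsequence, then the lattice tie
    have hLk := fun k => hL1 G r sch r.curvature B hB k ![gS, hS]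
    simp only [Matrix.cons_val_zero, Matrix.cons_val_one] at hLk
    have hlat := eventually_norm_truncated_le g h gS_apply hS_apply sch.a_pos hφa hφM hLk
    simp only [hgr, hhr] at hlat
    have hu := (htie 2 two_ne_zero ![gS, hS] F hFt hFoff).comp hφmono.tendsto_atTop
    have hv := (htie 1 one_ne_zero (fun _ => gS) F₀ hF₀
      (HypercubicLimit.Negative.isOffDiagonal_fin_one F₀)).comp hφmono.tendsto_atTop
    have hw := (htie 1 one_ne_zero (fun _ => hS) F₁ hF₁
      (HypercubicLimit.Negative.isOffDiagonal_fin_one F₁)).comp hφmono.tendsto_atTop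
    have hZ : ‖S₁ 2 F - S₁ 1 F₀ * S₁ 1 F₁‖ ≤ M ^ 2 * (2 * B) ^ 2 * (3 * ε) ^ 4 * (3 * ε) ^ 4 :=
      le_of_tendsto (hu.sub (hv.mul hw)).norm hlat
    -- (2) the disconnected part is `κ² (∫g)(∫h)`
    have hS1F₀ : S₁ 1 F₀ = κ * ((∫ y, g y : ℝ) : ℂ) := hκ gS F₀ hF₀
    have hS1F₁ : S₁ 1 F₁ = κ * ((∫ y, h y : ℝ) : ℂ) := hκ hS F₁ hF₁
    rw [hS1F₀, hS1F₁] at hZ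
    -- (3) continuum side: bump localisation of the representing kernel; (4) algebra
    obtain ⟨hint, hS2⟩ := hrep F hFoff
    have hsum : g.rOut + h.rOut ≤ ρ := by
      show ε + ε ≤ ρ
      linarith
    have h2 := norm_integral_kernel_bumps_sub_le hρK' g h hsum F_apply F.integrable hint
    rw [← hS2, norm_sub_rev] at h2
    exact norm_le_of_estimates hv₁ hε hI₀ hI₁ hZ h2
  -- ### the axial growth bound with `η = 10`
  refine ⟨‖κ‖ ^ 2 + 1 + M ^ 2 * (2 * B) ^ 2 * 6 ^ 8 / v₁ ^ 2, 10, by norm_num, fun s hs _ => ?_⟩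
  rw [sub_self, Real.rpow_zero, mul_one]
  exact hbound _ fun h0 => hs.ne' ((PiLp.single_eq_zero_iff 2 _).1 h0)

end Summit.QuantumFields.YangMills.Theorems.CurvatureKernel

end
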